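/-
Copyright (c) 2026 the pub-hodgecm-mathlib formalisation cell (harness21).  Prover seat hodgecm-mathlib-K2Liu-p08 (g0), Track B «K2-LIT»,
#184♮ = hLiu418 = `stmt-HodgeConjecture-24832`; LEAD F0P6-plan (g11) DEALS-req649 (S2′) 2026-09-04T05:28:07Z «#33b (a) (B) FINITE-PLACE
MAIN-ORBIT OPEN EMBEDDING», box 05:32:24Z «GO AS REPORTED»; after K2E5-p17 (g3)'s heir memo `CENSUS-33b-a-B` c0f3422280440fab;
inputs (A) ★ p857583, (A′) ★ p857600.  File (B-i) of two: the ALGEBRA of the decomposition at a finite place + the one analytic input.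
-/
import Summits.HodgeConjecture.HodgeConjecture.Theorems.K2LiuDoublingMainOrbitBlocksRing   -- ★ (A′) p857600 (imports ★ (A) p857583)
import Literature.NumberTheory.K2Lit.LocalDoublingEmbedding                                -- ★ `iotaGGLoc`, `localPairU`, `localForm_hermD_eq`
import Literature.NumberTheory.GelbartRogawski1991.DoubledUnitarySiegelPlaceComponents       -- ★ `GRConstruction.IsSiegelM`
import Mathlib.Topology.Instances.Matrix
import HarnessLib

/-!
# Crux `HLiu418`, road `K2_Liu`, socket #33b organ (a), file (B-i): the doubling MAIN ORBIT at a finite place `v` —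
# the decomposition `h = p · ι_v(x, 1)` (`p` Siegel, `x ∈ G_v`) on `Ω_v = {IsUnit M(h)}`, its uniqueness, and the analytic input

Cell `hodgecm-mathlib`, crux item hLiu418 = `stmt-HodgeConjecture-24832`; LEAD F0P6-plan (g11), box K2E5-r01 (g6), consumer K2E2-p12 (g3)
(#33b `sig_K2LiuSiegelBigCellSection`, organ (D) + assembly; RULING «M-155n» (3)(5)).  THEOREMS ONLY (no `def`, no instance, no notation,
no named-fact hypothesis, no `sorry`); lane `--supports stmt-HodgeConjecture-24832 --as helper` (count-neutral).  Sequel = file (B-ii)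
`K2LiuSiegelBigCellOpenEmbedding` (the topology: `Ω_v` open, open embedding, (D1) closedness).  The socket∕file NAME says «big cell»
(frozen, PSR's loose usage); the set is the doubling MAIN ORBIT `Ω_v = P_{Δ,v} · ι_v(G_v × 1)` (RULING «M-155n» (1)).

SETTING (★ `K2Lit/LocalDoublingEmbedding`).  CM field `L`, finite place `v` of `L⁺`, local ring `R = L_v = Π_{w ∣ v} L_w`
(★ `UnitaryGroup.LocalRing L v`) with involution `c = c ⊗ 1` (★ `UnitaryGroup.conjLocal`); the doubled group
`H_v = U(J^𝔻)(L⁺_v) ≤ GL_{n+n}(L_v)` (★ `UnitaryGroup.«local» … (n + n) (hermD L e dV hdV dW hdW) v`), whose form matrix is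
`reindex e₂ e₂ (𝕁′ ⊕ (−𝕁′))`, `𝕁′ = reindex e e 𝕁_v` (★ `localForm_hermD_eq`, `𝕁_v` = ★ `pairFormLoc L dV dW v`); the group
`G_v = U(𝕁_v) ≤ GL_{N M}(L_v)` (★ `localPairU`); the embedding `ι_v : G_v × G_v →* H_v` (★ `iotaGGLoc`, matrix
`reindex e₂ (diag (reindex e x₁, reindex e x₂))`, ★ `coe_iotaGGLoc`).  For `h ∈ H_v` write `B(h) := reindex e₂⁻¹ e₂⁻¹ h` (blocks on
`Fin n ⊕ Fin n`), `M(h) := B(h)₂₂ − B(h)₁₂`, `A(h) := M(h)⁻¹ (B(h)₁₁ − B(h)₂₁)`, `A°(h) := reindex e⁻¹ e⁻¹ A(h)` — all SPELLED OUT below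
(the matrix of an element is written `Units.val (Subtype.val h)`).  «`p` Siegel» = ★ `GRConstruction.IsSiegelM` (`B(p)₁₁ + B(p)₁₂ =
B(p)₂₁ + B(p)₂₂`, literally ★ (A)'s Siegel condition).

* §0 the ONE analytic input, Mathlib-only: `Ring.inverse` is continuous at every unit of a FINITE product of `T₁` topological groups with
  zero with continuous inversion (`continuousAt_ringInverse_pi`) — on the open box `{∀ i, y i ≠ 0}` it is `y ↦ (y i)⁻¹`; the units of such
  a product form an open set (`isOpen_setOf_isUnit_pi`).  Applies to `L_v = Π_{w∣v} L_w` (`Valued` fields).  NOT the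
  `NormedRing.inverse_continuousAt` road.
* §1 bookkeeping: `B(h h′) = B(h) B(h′)`, `B(ι_v(x₁, x₂)) = diag(reindex e x₁, reindex e x₂)`, `B(h)` is a `c`-isometry of `𝕁′ ⊕ (−𝕁′)`.
* §2 the decomposition (★ (A′) over `R = L_v`): `M(p · ι_v(x, 1))` is a unit for Siegel `p`; on `Ω_v = {IsUnit M(h)}` the matrix `A°(h)`
  is `𝕁_v`-unitary with unit determinant, `A⁻¹ = 𝕁⁻¹ ᵗ(c A) 𝕁` for unitary `A` (NO second inversion), for the element `x ∈ G_v` with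
  matrix `A°(h)` the element `h · ι_v(x, 1)⁻¹` is SIEGEL and `(h · ι_v(x, 1)⁻¹) · ι_v(x, 1) = h`; **the map `(p, x) ↦ p · ι_v(x, 1)` is
  INJECTIVE on `P_{Δ,v} × G_v`** (★ `siegel_mul_iota_unique_ring`).

[GelbartPiatetskishapiroRallis1987, Part A §1–§2 (the `G × G`-orbits on `P \ H`; the main orbit, stabiliser `G^Δ`)]
[Liu2021, §B.3 (B.5), Lem. B.11] [HarrisKudlaSweet1996, §1 (1.11)] [Liu2011, §2C p. 863].
HONEST LABEL.  Count-neutral helper; `HC_CM` is proved only modulo the 7 printed citations (2 remaining named inputs: hLiu418 =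
`stmt-HodgeConjecture-24832`, h413 = `stmt-HodgeConjecture-24833`) until rung 0 closes.
-/

set_option autoImplicit false
set_option linter.dupNamespace false -- the mandated namespace repeats `HodgeConjecture.HodgeConjecture`

noncomputable section

namespace Summit.HodgeConjecture.HodgeConjecture.Cruxes.HLiu418.K2LiuSiegelMainOrbitDecompositionLoc

open scoped Matrix
open Topology Filter
open NumberField IsDedekindDomain
open Literature.NumberTheory.Automorphic
open Literature.NumberTheory.GelbartRogawski1991 Literature.NumberTheory.GelbartRogawski1991.GRConstruction
open Literature.NumberTheory.K2Lit.SiegelDoubled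
open Summit.HodgeConjecture.HodgeConjecture.Cruxes.HLiu418.K2LiuDoublingMainOrbitBlocksUnit
open Summit.HodgeConjecture.HodgeConjecture.Cruxes.HLiu418.K2LiuDoublingMainOrbitBlocksRing

/-! ## §0 The analytic input: `Ring.inverse` on a finite product of topological fields -/

/-- **`Ring.inverse` is continuous at every unit of a finite product `Π i, K i`** of `T₁` topological groups with zero with continuous
inversion away from `0` (e.g. the local ring `L_v = Π_{w ∣ v} L_w` of `Valued` fields): near a unit it is `y ↦ (i ↦ (y i)⁻¹)` on the
open box `{∀ i, y i ≠ 0}`. [folklore] -/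
theorem continuousAt_ringInverse_pi {ι : Type*} [Finite ι] {K : ι → Type*} [∀ i, GroupWithZero (K i)]
    [∀ i, TopologicalSpace (K i)] [∀ i, ContinuousInv₀ (K i)] [∀ i, T1Space (K i)]
    {x : ∀ i, K i} (hx : IsUnit x) : ContinuousAt Ring.inverse x := by
  have hx' : ∀ i, x i ≠ 0 := fun i => ((Pi.isUnit_iff.1 hx) i).ne_zero
  have hU : IsOpen {y : ∀ i, K i | ∀ i, y i ≠ 0} := by
    have hUeq : {y : ∀ i, K i | ∀ i, y i ≠ 0} = ⋂ i, (fun y : ∀ i, K i => y i) ⁻¹' ({0}ᶜ : Set (K i)) := by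
      ext y
      simp only [Set.mem_setOf_eq, Set.mem_iInter, Set.mem_preimage, Set.mem_compl_iff, Set.mem_singleton_iff]
    rw [hUeq]
    exact isOpen_iInter_of_finite fun i => isOpen_compl_singleton.preimage (continuous_apply i)
  have hcont : ContinuousAt (fun y : ∀ i, K i => fun i => (y i)⁻¹) x :=
    continuousAt_pi.2 fun i => ((continuous_apply i).continuousAt).inv₀ (hx' i)
  refine hcont.congr (Filter.eventually_of_mem (hU.mem_nhds hx') fun y hy => ?_)
  have hyu : IsUnit y := Pi.isUnit_iff.2 fun i => isUnit_iff_ne_zero.2 (hy i)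
  have h1 := Ring.inverse_mul_cancel y hyu
  funext i
  have h2 : Ring.inverse y i * y i = 1 := by
    have h3 := congrFun h1 i
    rwa [Pi.mul_apply, Pi.one_apply] at h3
  exact (eq_inv_of_mul_eq_one_left h2).symm

/-- units of a product of groups with zero: `IsUnit y ↔ ∀ i, y i ≠ 0`. [folklore] -/
theorem isUnit_pi_iff_forall_ne_zero {ι : Type*} {K : ι → Type*} [∀ i, GroupWithZero (K i)] (y : ∀ i, K i) :
    IsUnit y ↔ ∀ i, y i ≠ 0 :=
  ⟨fun h i => ((Pi.isUnit_iff.1 h) i).ne_zero, fun h => Pi.isUnit_iff.2 fun i => isUnit_iff_ne_zero.2 (h i)⟩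

/-- **the units of a finite product of `T₁` groups with zero form an OPEN set.** [folklore] -/
theorem isOpen_setOf_isUnit_pi {ι : Type*} [Finite ι] {K : ι → Type*} [∀ i, GroupWithZero (K i)]
    [∀ i, TopologicalSpace (K i)] [∀ i, T1Space (K i)] : IsOpen {y : ∀ i, K i | IsUnit y} := by
  have hUeq : {y : ∀ i, K i | IsUnit y} = ⋂ i, (fun y : ∀ i, K i => y i) ⁻¹' ({0}ᶜ : Set (K i)) := by
    ext y
    simp only [Set.mem_setOf_eq, isUnit_pi_iff_forall_ne_zero, Set.mem_iInter, Set.mem_preimage, Set.mem_compl_iff,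
      Set.mem_singleton_iff]
  rw [hUeq]
  exact isOpen_iInter_of_finite fun i => isOpen_compl_singleton.preimage (continuous_apply i)

/-! ## §1 Bookkeeping in the `Δ`-block coordinates `B(h) = reindex e₂⁻¹ e₂⁻¹ h` -/

section Local

variable (L : Type) [Field L] [NumberField L] [IsCMField L]
variable {N M n : ℕ} (e : Fin N × Fin M ≃ Fin n)
  (dV : Fin N → L) (hdV : ∀ i, IsCMField.complexConj L (dV i) = dV i)
  (dW : Fin M → L) (hdW : ∀ i, IsCMField.complexConj L (dW i) = dW i)
  (v : HeightOneSpectrum (𝓞 (Fp L)))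

/-- `reindex e₂⁻¹ e₂⁻¹` is multiplicative (square matrices over any ring). [folklore] -/
theorem reindex_e₂_symm_mul {R : Type*} [CommRing R] (X Y : Matrix (Fin (n + n)) (Fin (n + n)) R) :
    Matrix.reindex (e₂ (n := n)).symm (e₂ (n := n)).symm (X * Y) =
      Matrix.reindex (e₂ (n := n)).symm (e₂ (n := n)).symm X * Matrix.reindex (e₂ (n := n)).symm (e₂ (n := n)).symm Y := by
  simp only [Matrix.reindex_apply, Equiv.symm_symm]
  exact (Matrix.submatrix_mul_equiv X Y _ (e₂ (n := n)) _).symm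

/-- `reindex e₂⁻¹ e₂⁻¹ (reindex e₂ e₂ X) = X`. [folklore] -/
theorem reindex_e₂_symm_reindex_e₂ {R : Type*} (X : Matrix (Fin n ⊕ Fin n) (Fin n ⊕ Fin n) R) :
    Matrix.reindex (e₂ (n := n)).symm (e₂ (n := n)).symm (Matrix.reindex (e₂ (n := n)) (e₂ (n := n)) X) = X := by
  rw [← Matrix.reindex_symm, Equiv.symm_apply_apply]

/-- `reindex e e (reindex e⁻¹ e⁻¹ Y) = Y`. [folklore] -/
theorem reindex_e_reindex_e_symm {R : Type*} (Y : Matrix (Fin n) (Fin n) R) :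
    Matrix.reindex e e (Matrix.reindex e.symm e.symm Y) = Y := by
  rw [← Matrix.reindex_symm, Equiv.apply_symm_apply]

/-- `reindex e₂⁻¹ e₂⁻¹ 1 = 1`. [folklore] -/
theorem reindex_e₂_symm_one {R : Type*} [CommRing R] :
    Matrix.reindex (e₂ (n := n)).symm (e₂ (n := n)).symm (1 : Matrix (Fin (n + n)) (Fin (n + n)) R) = 1 := by
  rw [Matrix.reindex_apply, Matrix.submatrix_one_equiv]

/-- **`B(h h′) = B(h) B(h′)`** for `h, h′ ∈ H_v`. [folklore] -/
theorem reindex_coe_mul (h h' : UnitaryGroup.«local» L (IsCMField.complexConj L) (n + n) (hermD L e dV hdV dW hdW) v) :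
    Matrix.reindex (e₂ (n := n)).symm (e₂ (n := n)).symm (Units.val (Subtype.val (h * h'))) =
      Matrix.reindex (e₂ (n := n)).symm (e₂ (n := n)).symm (Units.val (Subtype.val h)) *
        Matrix.reindex (e₂ (n := n)).symm (e₂ (n := n)).symm (Units.val (Subtype.val h')) := by
  rw [Subgroup.coe_mul, Units.val_mul, reindex_e₂_symm_mul]

/-- `B(1) = 1`. [folklore] -/
theorem reindex_coe_one :
    Matrix.reindex (e₂ (n := n)).symm (e₂ (n := n)).symm
        (Units.val (Subtype.val (1 : UnitaryGroup.«local» L (IsCMField.complexConj L) (n + n) (hermD L e dV hdV dW hdW) v))) = 1 := by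
  rw [Subgroup.coe_one, Units.val_one, reindex_e₂_symm_one]

/-- `B(h) B(h⁻¹) = 1`. [folklore] -/
theorem reindex_coe_mul_reindex_coe_inv (h : UnitaryGroup.«local» L (IsCMField.complexConj L) (n + n) (hermD L e dV hdV dW hdW) v) :
    Matrix.reindex (e₂ (n := n)).symm (e₂ (n := n)).symm (Units.val (Subtype.val h)) *
        Matrix.reindex (e₂ (n := n)).symm (e₂ (n := n)).symm (Units.val (Subtype.val h⁻¹)) = 1 := by
  rw [← reindex_coe_mul, mul_inv_cancel, reindex_coe_one]

/-- **`B(ι_v(x₁, x₂)) = diag(reindex e x₁, reindex e x₂)`** (★ `coe_iotaGGLoc`). [cite: HarrisKudlaSweet1996, §1 (1.11)] -/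
theorem reindex_coe_iotaGGLoc (x₁ x₂ : localPairU L dV dW v) :
    Matrix.reindex (e₂ (n := n)).symm (e₂ (n := n)).symm (Units.val (Subtype.val (iotaGGLoc L e dV hdV dW hdW v (x₁, x₂)))) =
      Matrix.fromBlocks (Matrix.reindex e e (Units.val (Subtype.val x₁))) 0 0 (Matrix.reindex e e (Units.val (Subtype.val x₂))) := by
  rw [coe_iotaGGLoc, UnitaryGroup.coe_reindexGL, UnitaryGroup.coe_blockDiagGL, UnitaryGroup.coe_reindexGL,
    UnitaryGroup.coe_reindexGL, reindex_e₂_symm_reindex_e₂]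

/-- `B(ι_v(x, 1)) = diag(reindex e x, 1)`. [cite: HarrisKudlaSweet1996, §1 (1.11)] -/
theorem reindex_coe_iotaGGLoc_one (x : localPairU L dV dW v) :
    Matrix.reindex (e₂ (n := n)).symm (e₂ (n := n)).symm (Units.val (Subtype.val (iotaGGLoc L e dV hdV dW hdW v (x, 1)))) =
      Matrix.fromBlocks (Matrix.reindex e e (Units.val (Subtype.val x))) 0 0 1 := by
  rw [reindex_coe_iotaGGLoc, Subgroup.coe_one, Units.val_one]
  simp only [Matrix.reindex_apply, Matrix.submatrix_one_equiv]

/-- `B(p · ι_v(x, 1)) = B(p) · diag(reindex e x, 1)`. [cite: HarrisKudlaSweet1996, §1 (1.11)] -/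
theorem reindex_coe_mul_iotaGGLoc_one (p : UnitaryGroup.«local» L (IsCMField.complexConj L) (n + n) (hermD L e dV hdV dW hdW) v)
    (x : localPairU L dV dW v) :
    Matrix.reindex (e₂ (n := n)).symm (e₂ (n := n)).symm (Units.val (Subtype.val (p * iotaGGLoc L e dV hdV dW hdW v (x, 1)))) =
      Matrix.reindex (e₂ (n := n)).symm (e₂ (n := n)).symm (Units.val (Subtype.val p)) *
        Matrix.fromBlocks (Matrix.reindex e e (Units.val (Subtype.val x))) 0 0 1 := by
  rw [reindex_coe_mul, reindex_coe_iotaGGLoc_one]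

/-- **`B(h)` is a `c`-isometry of `𝕁′ ⊕ (−𝕁′)`**, `𝕁′ = reindex e e 𝕁_v` (membership in `H_v` read through ★ `localForm_hermD_eq`).
[cite: HarrisKudlaSweet1996, §1 (1.9)] -/
theorem isometry_reindex_coe (h : UnitaryGroup.«local» L (IsCMField.complexConj L) (n + n) (hermD L e dV hdV dW hdW) v) :
    ((Matrix.reindex (e₂ (n := n)).symm (e₂ (n := n)).symm (Units.val (Subtype.val h))).map
          (UnitaryGroup.conjLocal L (IsCMField.complexConj L) v))ᵀ *
        Matrix.fromBlocks (Matrix.reindex e e (pairFormLoc L dV dW v)) 0 0 (-Matrix.reindex e e (pairFormLoc L dV dW v)) *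
      Matrix.reindex (e₂ (n := n)).symm (e₂ (n := n)).symm (Units.val (Subtype.val h)) =
      Matrix.fromBlocks (Matrix.reindex e e (pairFormLoc L dV dW v)) 0 0 (-Matrix.reindex e e (pairFormLoc L dV dW v)) := by
  have hmem : ((Units.val (Subtype.val h)).map (UnitaryGroup.conjLocal L (IsCMField.complexConj L) v))ᵀ *
        (UnitaryGroup.adelicForm L (n + n) (hermD L e dV hdV dW hdW)).map (UnitaryGroup.adeleToLocal L v) *
      Units.val (Subtype.val h) =
      (UnitaryGroup.adelicForm L (n + n) (hermD L e dV hdV dW hdW)).map (UnitaryGroup.adeleToLocal L v) := h.2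
  rw [localForm_hermD_eq] at hmem
  have key := congrArg (Matrix.reindex (e₂ (n := n)).symm (e₂ (n := n)).symm) hmem
  rw [reindex_e₂_symm_mul, reindex_e₂_symm_mul, reindex_e₂_symm_reindex_e₂, ← Matrix.transpose_reindex,
    ← UnitaryGroup.reindex_map] at key
  exact key

omit [IsCMField L] in
/-- `det 𝕁′ = det 𝕁_v` is a unit when `det 𝕁_v` is. [folklore] -/
theorem isUnit_det_reindex_pairFormLoc (hJ : IsUnit (pairFormLoc L dV dW v).det) :
    IsUnit (Matrix.reindex e e (pairFormLoc L dV dW v)).det := by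
  rwa [Matrix.det_reindex_self]

/-! ## §2 The decomposition `h = p · ι_v(x, 1)` on `Ω_v = {IsUnit M(h)}` (★ (A′) over `L_v`) -/

/-- **`M(p · ι_v(x, 1))` is a unit** for Siegel `p ∈ H_v` and `x ∈ G_v` (`Ω_v ⊇ P_{Δ,v} · ι_v(G_v × 1)`; ★ (A) §1).
[cite: GelbartPiatetskishapiroRallis1987, Part A §1] -/
theorem isUnit_mainOrbitBlock_siegel_mul_iotaGGLoc
    (p : UnitaryGroup.«local» L (IsCMField.complexConj L) (n + n) (hermD L e dV hdV dW hdW) v)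
    (hp : IsSiegelM (n := n) (Units.val (Subtype.val p))) (x : localPairU L dV dW v) :
    IsUnit ((Matrix.reindex (e₂ (n := n)).symm (e₂ (n := n)).symm
          (Units.val (Subtype.val (p * iotaGGLoc L e dV hdV dW hdW v (x, 1))))).toBlocks₂₂ -
        (Matrix.reindex (e₂ (n := n)).symm (e₂ (n := n)).symm
          (Units.val (Subtype.val (p * iotaGGLoc L e dV hdV dW hdW v (x, 1))))).toBlocks₁₂) := by
  rw [reindex_coe_mul_iotaGGLoc_one]
  exact isUnit_toBlocks_sub_siegel_mul_iota _
    (isUnit_toBlocks_sub_of_siegel_mul_eq_one _ _ hp (reindex_coe_mul_reindex_coe_inv L e dV hdV dW hdW v p)) _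

/-- `M(1) = 1` is a unit: `1 ∈ Ω_v`. [folklore] -/
theorem isUnit_mainOrbitBlock_one :
    IsUnit ((Matrix.reindex (e₂ (n := n)).symm (e₂ (n := n)).symm
          (Units.val (Subtype.val (1 : UnitaryGroup.«local» L (IsCMField.complexConj L) (n + n) (hermD L e dV hdV dW hdW) v)))).toBlocks₂₂ -
        (Matrix.reindex (e₂ (n := n)).symm (e₂ (n := n)).symm
          (Units.val (Subtype.val (1 : UnitaryGroup.«local» L (IsCMField.complexConj L) (n + n) (hermD L e dV hdV dW hdW) v)))).toBlocks₁₂) := by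
  rw [reindex_coe_one, toBlocks_sub_one]
  exact isUnit_one

/-- **`A°(h) = reindex e⁻¹ e⁻¹ (M(h)⁻¹ (B(h)₁₁ − B(h)₂₁))` is `𝕁_v`-unitary** on `Ω_v` (★ (A′) `unitary_mainOrbitBlock_ring`, re-enumerated by `e`).
[cite: Liu2021, §B.3 (B.5) p. 101] [cite: GelbartPiatetskishapiroRallis1987, Part A §1] -/
theorem unitary_mainOrbitInv (h : UnitaryGroup.«local» L (IsCMField.complexConj L) (n + n) (hermD L e dV hdV dW hdW) v)
    (hM : IsUnit ((Matrix.reindex (e₂ (n := n)).symm (e₂ (n := n)).symm (Units.val (Subtype.val h))).toBlocks₂₂ -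
      (Matrix.reindex (e₂ (n := n)).symm (e₂ (n := n)).symm (Units.val (Subtype.val h))).toBlocks₁₂)) :
    ((Matrix.reindex e.symm e.symm
          (((Matrix.reindex (e₂ (n := n)).symm (e₂ (n := n)).symm (Units.val (Subtype.val h))).toBlocks₂₂ -
              (Matrix.reindex (e₂ (n := n)).symm (e₂ (n := n)).symm (Units.val (Subtype.val h))).toBlocks₁₂)⁻¹ *
            ((Matrix.reindex (e₂ (n := n)).symm (e₂ (n := n)).symm (Units.val (Subtype.val h))).toBlocks₁₁ -
              (Matrix.reindex (e₂ (n := n)).symm (e₂ (n := n)).symm (Units.val (Subtype.val h))).toBlocks₂₁))).map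
          (UnitaryGroup.conjLocal L (IsCMField.complexConj L) v))ᵀ *
        pairFormLoc L dV dW v *
      Matrix.reindex e.symm e.symm
          (((Matrix.reindex (e₂ (n := n)).symm (e₂ (n := n)).symm (Units.val (Subtype.val h))).toBlocks₂₂ -
              (Matrix.reindex (e₂ (n := n)).symm (e₂ (n := n)).symm (Units.val (Subtype.val h))).toBlocks₁₂)⁻¹ *
            ((Matrix.reindex (e₂ (n := n)).symm (e₂ (n := n)).symm (Units.val (Subtype.val h))).toBlocks₁₁ -
              (Matrix.reindex (e₂ (n := n)).symm (e₂ (n := n)).symm (Units.val (Subtype.val h))).toBlocks₂₁)) =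
      pairFormLoc L dV dW v := by
  have hA := unitary_mainOrbitBlock_ring (UnitaryGroup.conjLocal L (IsCMField.complexConj L) v)
    (Matrix.reindex e e (pairFormLoc L dV dW v)) _ (isometry_reindex_coe L e dV hdV dW hdW v h) hM
  have key := congrArg (fun X => Matrix.submatrix X ⇑e ⇑e) hA
  beta_reduce at key
  rw [← Matrix.submatrix_mul_equiv _ _ _ e _, ← Matrix.submatrix_mul_equiv _ _ _ e _] at key
  have hJJ : (Matrix.reindex e e (pairFormLoc L dV dW v)).submatrix e e = pairFormLoc L dV dW v := by
    rw [Matrix.reindex_apply, Matrix.submatrix_submatrix, Equiv.symm_comp_self, Matrix.submatrix_id_id]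
  rw [hJJ, ← Matrix.transpose_submatrix, Matrix.submatrix_map] at key
  simpa only [Matrix.reindex_apply, Equiv.symm_symm] using key

/-- **`det A°(h)` is a unit** on `Ω_v` (★ (A′) `isUnit_mainOrbitBlock_ring`). [cite: Liu2021, Lem. B.11 p. 102] -/
theorem isUnit_det_mainOrbitInv (hJ : IsUnit (pairFormLoc L dV dW v).det)
    (h : UnitaryGroup.«local» L (IsCMField.complexConj L) (n + n) (hermD L e dV hdV dW hdW) v)
    (hM : IsUnit ((Matrix.reindex (e₂ (n := n)).symm (e₂ (n := n)).symm (Units.val (Subtype.val h))).toBlocks₂₂ -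
      (Matrix.reindex (e₂ (n := n)).symm (e₂ (n := n)).symm (Units.val (Subtype.val h))).toBlocks₁₂)) :
    IsUnit (Matrix.reindex e.symm e.symm
          (((Matrix.reindex (e₂ (n := n)).symm (e₂ (n := n)).symm (Units.val (Subtype.val h))).toBlocks₂₂ -
              (Matrix.reindex (e₂ (n := n)).symm (e₂ (n := n)).symm (Units.val (Subtype.val h))).toBlocks₁₂)⁻¹ *
            ((Matrix.reindex (e₂ (n := n)).symm (e₂ (n := n)).symm (Units.val (Subtype.val h))).toBlocks₁₁ -
              (Matrix.reindex (e₂ (n := n)).symm (e₂ (n := n)).symm (Units.val (Subtype.val h))).toBlocks₂₁))).det := by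
  rw [Matrix.det_reindex_self, ← Matrix.isUnit_iff_isUnit_det]
  exact isUnit_mainOrbitBlock_ring (UnitaryGroup.conjLocal L (IsCMField.complexConj L) v)
    (isUnit_det_reindex_pairFormLoc L e dV dW v hJ) _ (isometry_reindex_coe L e dV hdV dW hdW v h) hM

/-- a `𝕁`-unitary invertible matrix has `A⁻¹ = 𝕁⁻¹ ᵗ(c A) 𝕁` (`det 𝕁` a unit) — the inverse WITHOUT a second matrix inversion. [folklore] -/
theorem inv_eq_of_unitary {R : Type*} [CommRing R] {m : Type*} [Fintype m] [DecidableEq m] (c : R →+* R)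
    {J A : Matrix m m R} (hJ : IsUnit J.det) (hA : (A.map c)ᵀ * J * A = J) : A⁻¹ = J⁻¹ * (A.map c)ᵀ * J := by
  refine Matrix.inv_eq_left_inv ?_
  rw [Matrix.mul_assoc, Matrix.mul_assoc, ← Matrix.mul_assoc (A.map c)ᵀ, hA, Matrix.nonsing_inv_mul _ hJ]

/-- **the Siegel factor**: for `h ∈ Ω_v` and `x ∈ G_v` with matrix `A°(h)`, the element `h · ι_v(x, 1)⁻¹ ∈ H_v` is SIEGEL
(★ (A′) `siegel_of_mainOrbit_block_ring`: its `B` is `B(h) · diag(A(h)⁻¹, 1)`). [cite: Liu2021, Lem. B.11 p. 102]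
[cite: GelbartPiatetskishapiroRallis1987, Part A §1] -/
theorem isSiegelM_mul_iotaGGLoc_inv (hJ : IsUnit (pairFormLoc L dV dW v).det)
    (h : UnitaryGroup.«local» L (IsCMField.complexConj L) (n + n) (hermD L e dV hdV dW hdW) v)
    (hM : IsUnit ((Matrix.reindex (e₂ (n := n)).symm (e₂ (n := n)).symm (Units.val (Subtype.val h))).toBlocks₂₂ -
      (Matrix.reindex (e₂ (n := n)).symm (e₂ (n := n)).symm (Units.val (Subtype.val h))).toBlocks₁₂))
    (x : localPairU L dV dW v)
    (hx : Units.val (Subtype.val x) = Matrix.reindex e.symm e.symm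
          (((Matrix.reindex (e₂ (n := n)).symm (e₂ (n := n)).symm (Units.val (Subtype.val h))).toBlocks₂₂ -
              (Matrix.reindex (e₂ (n := n)).symm (e₂ (n := n)).symm (Units.val (Subtype.val h))).toBlocks₁₂)⁻¹ *
            ((Matrix.reindex (e₂ (n := n)).symm (e₂ (n := n)).symm (Units.val (Subtype.val h))).toBlocks₁₁ -
              (Matrix.reindex (e₂ (n := n)).symm (e₂ (n := n)).symm (Units.val (Subtype.val h))).toBlocks₂₁))) :
    IsSiegelM (n := n) (Units.val (Subtype.val (h * (iotaGGLoc L e dV hdV dW hdW v (x, 1))⁻¹))) := by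
  have hAu := isUnit_mainOrbitBlock_ring (UnitaryGroup.conjLocal L (IsCMField.complexConj L) v)
    (isUnit_det_reindex_pairFormLoc L e dV dW v hJ) _ (isometry_reindex_coe L e dV hdV dW hdW v h) hM
  have hMdet := (Matrix.isUnit_iff_isUnit_det _).1 hM
  -- the matrix of `h · ι_v(x,1)⁻¹` in `Δ`-blocks is `B(h) · diag(A(h)⁻¹, 1)`
  have hmat : Matrix.reindex (e₂ (n := n)).symm (e₂ (n := n)).symm
        (Units.val (Subtype.val (h * (iotaGGLoc L e dV hdV dW hdW v (x, 1))⁻¹))) =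
      Matrix.reindex (e₂ (n := n)).symm (e₂ (n := n)).symm (Units.val (Subtype.val h)) *
        Matrix.fromBlocks
          (((Matrix.reindex (e₂ (n := n)).symm (e₂ (n := n)).symm (Units.val (Subtype.val h))).toBlocks₂₂ -
                (Matrix.reindex (e₂ (n := n)).symm (e₂ (n := n)).symm (Units.val (Subtype.val h))).toBlocks₁₂)⁻¹ *
              ((Matrix.reindex (e₂ (n := n)).symm (e₂ (n := n)).symm (Units.val (Subtype.val h))).toBlocks₁₁ -
                (Matrix.reindex (e₂ (n := n)).symm (e₂ (n := n)).symm (Units.val (Subtype.val h))).toBlocks₂₁))⁻¹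
          0 0 1 := by
    have hinv : (iotaGGLoc L e dV hdV dW hdW v (x, 1))⁻¹ = iotaGGLoc L e dV hdV dW hdW v (x⁻¹, 1) := by
      change (((iotaGGLoc L e dV hdV dW hdW v).comp (MonoidHom.inl _ _)) x)⁻¹ =
        ((iotaGGLoc L e dV hdV dW hdW v).comp (MonoidHom.inl _ _)) x⁻¹
      rw [map_inv]
    rw [hinv, reindex_coe_mul_iotaGGLoc_one, Subgroup.coe_inv, Matrix.coe_units_inv, hx, Matrix.inv_reindex,
      reindex_e_reindex_e_symm]
  unfold IsSiegelM
  rw [hmat]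
  exact siegel_of_mainOrbit_block_ring _ hAu (by rw [← Matrix.mul_assoc, Matrix.mul_nonsing_inv _ hMdet, Matrix.one_mul])

/-- `p · ι_v(x, 1) = h` for `p := h · ι_v(x, 1)⁻¹` (group bookkeeping). [folklore] -/
theorem mul_iotaGGLoc_inv_mul (h : UnitaryGroup.«local» L (IsCMField.complexConj L) (n + n) (hermD L e dV hdV dW hdW) v)
    (x : localPairU L dV dW v) :
    h * (iotaGGLoc L e dV hdV dW hdW v (x, 1))⁻¹ * iotaGGLoc L e dV hdV dW hdW v (x, 1) = h :=
  inv_mul_cancel_right h _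

/-- **INJECTIVITY of `(p, x) ↦ p · ι_v(x, 1)` on `P_{Δ,v} × G_v`** (★ (A′) `siegel_mul_iota_unique_ring`: the `G`-coordinate is `A(h)`).
[cite: GelbartPiatetskishapiroRallis1987, Part A §1 (stabiliser `G^Δ`)] [cite: Liu2021, Lem. B.11] -/
theorem injective_siegel_mul_iotaGGLoc :
    Function.Injective (fun px :
        {p : UnitaryGroup.«local» L (IsCMField.complexConj L) (n + n) (hermD L e dV hdV dW hdW) v //
            IsSiegelM (n := n) (Units.val (Subtype.val p))} × localPairU L dV dW v =>
      (px.1.1 : UnitaryGroup.«local» L (IsCMField.complexConj L) (n + n) (hermD L e dV hdV dW hdW) v) *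
        iotaGGLoc L e dV hdV dW hdW v (px.2, 1)) := by
  rintro ⟨⟨p, hp⟩, x⟩ ⟨⟨p', hp'⟩, x'⟩ hpx
  simp only at hpx
  have hmat := congrArg (fun k : UnitaryGroup.«local» L (IsCMField.complexConj L) (n + n) (hermD L e dV hdV dW hdW) v =>
    Matrix.reindex (e₂ (n := n)).symm (e₂ (n := n)).symm (Units.val (Subtype.val k))) hpx
  simp only [reindex_coe_mul_iotaGGLoc_one] at hmat
  have hMP := isUnit_toBlocks_sub_of_siegel_mul_eq_one _ _ hp (reindex_coe_mul_reindex_coe_inv L e dV hdV dW hdW v p)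
  obtain ⟨hA, hP⟩ := siegel_mul_iota_unique_ring hp hp' hMP hmat
  have hxx : x = x' :=
    Subtype.ext (Units.ext ((Matrix.reindex e e).injective hA))
  have hux : IsUnit (Matrix.reindex e e (Units.val (Subtype.val x))) := by
    rw [Matrix.isUnit_iff_isUnit_det, Matrix.det_reindex_self, ← Matrix.isUnit_iff_isUnit_det]
    exact Units.isUnit _
  have hpp : p = p' :=
    Subtype.ext (Units.ext ((Matrix.reindex (e₂ (n := n)).symm (e₂ (n := n)).symm).injective (hP hux)))
  subst hxx
  subst hpp
  rfl

end Local

end Summit.HodgeConjecture.HodgeConjecture.Cruxes.HLiu418.K2LiuSiegelMainOrbitDecompositionLoc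

end
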